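import Summits.BirchSwinnertonDyer.BirchSwinnertonDyer.Theorems.PrintCf2DisegniPairTwoLawRigidity
import Summits.BirchSwinnertonDyer.BirchSwinnertonDyer.Theorems.PrintCf2DisegniPairTwoFrameCurves
import HarnessLib

/-!
# Road (C) `disegni-pair-two` on crux stmt-BirchSwinnertonDyer-20368 — the (Δ1) descent law is RIGID: class rigidity theorems,
# and (Δ1) VERBATIM from its existential form «one datum per member»

Cell `bsd-print-cf2`, width seat `bsd-line-cf2-p1-w8` (g30), `--supports stmt-BirchSwinnertonDyer-20368` (helper; LEAD g25's
«TIGHTNESS» §5(iv)). THEOREMS ONLY (no `def`, no named fact introduced, no `sorry`). Sequel of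
`PrintCf2DisegniPairTwoLawRigidity.lean` (R1 unit root, R2 newform pin, R3 periods, R4 height model/datum-free, R5 generator-free).

* §1 the three CLASS RIGIDITY theorems `lawLHS_chi8_rigid`, `lawLHS_chi4_rigid`, `lawLHS_chi8'_rigid`: the left-hand side
  `v(D(f, α_V)) + v₂(ϖ|μ) − v(Dc.pairing P P)` of the registered research stub (Δ1) `stub_law_descent_two`
  (`Cruxes/SplitBadTwoRankOneOfFacts/Lines/disegni_pair_two.lean` v3.5–v3.10) takes the same value at any two data
  `(V, C₁, f, ϖ|μ, P, Dc)` over the same `d′`;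
* §2 ★★ `lawDescent_two_of_forall_exists` — (Δ1) VERBATIM follows from its EXISTENTIAL form «for every `7`-free member `W` of each
  class there is SOME datum at which the identity holds» (one class function `e_D`): a prover of the (Δ1) item may work at any
  convenient datum per member (e.g. the frame's explicit `V = W_k`, its newform, its generator);
The sequel `PrintCf2DisegniPairTwoLawSocketOfExists.lean` (in the route cone) feeds §2 into the LEAD g25 law socket: the crux from the
twelve prints and the EXISTENTIAL law. This file has no `Theses` import.

READING: 20368 = 12 primary prints + (Δ1) is UNCHANGED (the existential form is implied by (Δ1) trivially and implies it by §2, so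
they are EQUIVALENT); nothing here proves (Δ1) or the crux; BSD is not proved by any of this.

References: B. Mazur, J. Tate, J. Teitelbaum, Invent. Math. 84 (1986) §I.13–I.14 [MazurTateTeitelbaum1986Invent]; B. Perrin-Riou,
Invent. Math. 89 (1987) Thm. 1.3 [PerrinRiou1987]; B. Mazur, W. Stein, J. Tate (2006) §1 [MazurSteinTate2006]; D. Disegni,
Compos. Math. 153 (2017) Thm. B [Disegni2017].
-/

set_option autoImplicit false
set_option linter.dupNamespace false

noncomputable section

open scoped Classical MatrixGroups ModularForm NumberField

open CongruenceSubgroup WeierstrassCurve Literature.NumberTheory.EllipticCurves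
  Literature.NumberTheory.EllipticCurves.ModularForms
  Summit.BirchSwinnertonDyer.BirchSwinnertonDyer.Theorems.InertBadSignedBranchesInertBadAtThreeQuarticModel

namespace Summit.BirchSwinnertonDyer.BirchSwinnertonDyer.Theorems.PrintCf2.DisegniPairTwo

/-! ### §1 The three class rigidity theorems -/

/-- ★ **CLASS RIGIDITY, `χ₈∘N` (`d = 2d′`): the left-hand side `v(D) + v₂(ϖ) − v(h)` of the (Δ1) law is the same at any two data**
`(V, C₁, f, ϖ, P, Dc)`, `(V′, C₁′, f′, ϖ′, P′, Dc′)` over the same `d′`: `α_V = α_{V′}` (§2), `f = f′` on the nose (§3; `IsNewformOf`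
transported §3), `ϖ = ϖ′` (§4, `Ω(V) = Ω(V′) > 0`), `Dc.pairing P P = Dc′.pairing P′ P′` (§6 `pairing_generator_rigid`).
[cite: MazurTateTeitelbaum1986Invent, §I.14] [cite: MazurSteinTate2006, §1] -/
theorem lawLHS_chi8_rigid {d' : ℤ} (hd4 : d' % 4 = 1) (hsq : Squarefree d')
    (V : WeierstrassCurve ℚ) [V.IsElliptic] [V.IsGloballyMinimal] (C₁ : VariableChange ℚ)
    (hC₁ : C₁ • V = cm7.quadraticTwist (d' : ℚ))
    {N : ℕ} [NeZero N] (f : CuspForm (Gamma0 N) 2) (hf : IsNewformOf V f)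
    (ϖ : ℚ) (hϖ : (ϖ : ℝ) * V.realPeriodRat = plusPeriod f)
    (P : (V.quadraticTwist 2).toAffine.Point)
    (hgen : ∀ R : (V.quadraticTwist 2).toAffine.Point,
      ∃ (k : ℤ) (T : (V.quadraticTwist 2).toAffine.Point), IsOfFinAddOrder T ∧ R = k • P + T)
    (Dc : PAdicHeightData (V.quadraticTwist 2) 2) (hDc : Dc.IsCanonicalSqMinusTwist)
    (V' : WeierstrassCurve ℚ) [V'.IsElliptic] [V'.IsGloballyMinimal] (C₁' : VariableChange ℚ)
    (hC₁' : C₁' • V' = cm7.quadraticTwist (d' : ℚ))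
    {N' : ℕ} [NeZero N'] (f' : CuspForm (Gamma0 N') 2) (hf' : IsNewformOf V' f')
    (ϖ' : ℚ) (hϖ' : (ϖ' : ℝ) * V'.realPeriodRat = plusPeriod f')
    (P' : (V'.quadraticTwist 2).toAffine.Point)
    (hgen' : ∀ R : (V'.quadraticTwist 2).toAffine.Point,
      ∃ (k : ℤ) (T : (V'.quadraticTwist 2).toAffine.Point), IsOfFinAddOrder T ∧ R = k • P' + T)
    (Dc' : PAdicHeightData (V'.quadraticTwist 2) 2) (hDc' : Dc'.IsCanonicalSqMinusTwist) :
    (∑' k : ℕ, PowerSeries.coeff k (padicLFunction f (unitRoot V 2 : ℚ_[2])) * (k : ℚ_[2]) *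
        (-2) ^ (k - 1)).valuation + padicValRat 2 ϖ - (Dc.pairing P P).valuation =
    (∑' k : ℕ, PowerSeries.coeff k (padicLFunction f' (unitRoot V' 2 : ℚ_[2])) * (k : ℚ_[2]) *
        (-2) ^ (k - 1)).valuation + padicValRat 2 ϖ' - (Dc'.pairing P' P').valuation := by
  haveI : Fact (2 : ℕ).Prime := ⟨Nat.prime_two⟩
  obtain ⟨D, hD, hu, r, s, t, -, -, -⟩ := exists_integral_smul_eq_of_models V V' C₁ C₁' hC₁ hC₁'
  -- (R1) unit root
  have hα := unitRoot_two_eq_of_smul_eq V V' hD (cm7_quadraticTwist_hasGoodReductionAtPrime_two hd4 V C₁ hC₁)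
  -- (R2) newform
  have hfV : IsNewformOf V f' := (isNewformOf_iff_of_smul_eq hD f').mp hf'
  obtain ⟨hL, -, hOmPlus, -⟩ := newform_quantities_eq_of_isNewformOf hf hfV (unitRoot V 2 : ℚ_[2])
  -- (R3) period ratio
  obtain ⟨hΩ, -⟩ := periods_eq_of_smul_eq hD hu
  have hϖeq : ϖ = ϖ' :=
    ratio_eq_of_mul_eq (realPeriodRat_pos_holds V).ne' hϖ (by rw [← hΩ, hϖ', hOmPlus])
  -- (R4,R5) height
  have hh : Dc.pairing P P = Dc'.pairing P' P' :=
    pairing_generator_rigid hd4 hsq (d := 2) (Or.inr (Or.inl rfl)) V C₁ hC₁ P hgen Dc hDc V' C₁' hC₁' P' hgen' Dc' hDc'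
  rw [← hα, ← hL, ← hϖeq, hh]


/-- ★ **CLASS RIGIDITY, `χ₋₄∘N` (`d = −d′`): the left-hand side `v([T¹]L₂⁻(f,α)) + v₂(μ) − v(h)` of the (Δ1) law is the same at any two data**
`(V, C₁, f, μ, P, Dc)`, `(V′, C₁′, f′, μ′, P′, Dc′)` over the same `d′` (§2 unit root, §3 newform pinned, §4 `Ω⁻(V) = Ω⁻(V′) > 0`,
§6 `pairing_generator_rigid` at `d = -1`). [cite: MazurTateTeitelbaum1986Invent, §I.13–I.14] [cite: MazurSteinTate2006, §1] -/
theorem lawLHS_chi4_rigid {d' : ℤ} (hd4 : d' % 4 = 1) (hsq : Squarefree d')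
    (V : WeierstrassCurve ℚ) [V.IsElliptic] [V.IsGloballyMinimal] (C₁ : VariableChange ℚ)
    (hC₁ : C₁ • V = cm7.quadraticTwist (d' : ℚ))
    {N : ℕ} [NeZero N] (f : CuspForm (Gamma0 N) 2) (hf : IsNewformOf V f)
    (μ : ℚ) (hμ : (μ : ℝ) * V.imaginaryPeriodRat = minusPeriod f)
    (P : (V.quadraticTwist (-1)).toAffine.Point)
    (hgen : ∀ R : (V.quadraticTwist (-1)).toAffine.Point,
      ∃ (k : ℤ) (T : (V.quadraticTwist (-1)).toAffine.Point), IsOfFinAddOrder T ∧ R = k • P + T)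
    (Dc : PAdicHeightData (V.quadraticTwist (-1)) 2) (hDc : Dc.IsCanonicalSqMinusTwist)
    (V' : WeierstrassCurve ℚ) [V'.IsElliptic] [V'.IsGloballyMinimal] (C₁' : VariableChange ℚ)
    (hC₁' : C₁' • V' = cm7.quadraticTwist (d' : ℚ))
    {N' : ℕ} [NeZero N'] (f' : CuspForm (Gamma0 N') 2) (hf' : IsNewformOf V' f')
    (μ' : ℚ) (hμ' : (μ' : ℝ) * V'.imaginaryPeriodRat = minusPeriod f')
    (P' : (V'.quadraticTwist (-1)).toAffine.Point)
    (hgen' : ∀ R : (V'.quadraticTwist (-1)).toAffine.Point,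
      ∃ (k : ℤ) (T : (V'.quadraticTwist (-1)).toAffine.Point), IsOfFinAddOrder T ∧ R = k • P' + T)
    (Dc' : PAdicHeightData (V'.quadraticTwist (-1)) 2) (hDc' : Dc'.IsCanonicalSqMinusTwist) :
    (PowerSeries.coeff 1 (padicLFunctionMinusBranch f (unitRoot V 2 : ℚ_[2]) 1)).valuation + padicValRat 2 μ - (Dc.pairing P P).valuation =
    (PowerSeries.coeff 1 (padicLFunctionMinusBranch f' (unitRoot V' 2 : ℚ_[2]) 1)).valuation + padicValRat 2 μ' - (Dc'.pairing P' P').valuation := by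
  haveI : Fact (2 : ℕ).Prime := ⟨Nat.prime_two⟩
  obtain ⟨D, hD, hu, r, s, t, -, -, -⟩ := exists_integral_smul_eq_of_models V V' C₁ C₁' hC₁ hC₁'
  -- (R1) unit root
  have hα := unitRoot_two_eq_of_smul_eq V V' hD (cm7_quadraticTwist_hasGoodReductionAtPrime_two hd4 V C₁ hC₁)
  -- (R2) newform
  have hfV : IsNewformOf V f' := (isNewformOf_iff_of_smul_eq hD f').mp hf'
  obtain ⟨-, hL, -, hOm⟩ := newform_quantities_eq_of_isNewformOf hf hfV (unitRoot V 2 : ℚ_[2])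
  -- (R3) period ratio
  obtain ⟨-, hΩ⟩ := periods_eq_of_smul_eq hD hu
  have hreq : μ = μ' :=
    ratio_eq_of_mul_eq V.imaginaryPeriodRat_pos.ne' hμ (by rw [← hΩ, hμ', hOm])
  -- (R4,R5) height
  have hh : Dc.pairing P P = Dc'.pairing P' P' :=
    pairing_generator_rigid hd4 hsq (d := -1) (Or.inl rfl) V C₁ hC₁ P hgen Dc hDc V' C₁' hC₁' P' hgen' Dc' hDc'
  rw [← hα, ← hL, ← hreq, hh]

/-- ★ **CLASS RIGIDITY, `χ₋₈∘N` (`d = −2d′`): the left-hand side `v(Σ_k k[T^k]L₂⁻(f,α)(−2)^{k−1}) + v₂(μ) − v(h)` of the (Δ1) law is the same at any two data**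
`(V, C₁, f, μ, P, Dc)`, `(V′, C₁′, f′, μ′, P′, Dc′)` over the same `d′` (§2 unit root, §3 newform pinned, §4 `Ω⁻(V) = Ω⁻(V′) > 0`,
§6 `pairing_generator_rigid` at `d = -2`). [cite: MazurTateTeitelbaum1986Invent, §I.13–I.14] [cite: MazurSteinTate2006, §1] -/
theorem lawLHS_chi8'_rigid {d' : ℤ} (hd4 : d' % 4 = 1) (hsq : Squarefree d')
    (V : WeierstrassCurve ℚ) [V.IsElliptic] [V.IsGloballyMinimal] (C₁ : VariableChange ℚ)
    (hC₁ : C₁ • V = cm7.quadraticTwist (d' : ℚ))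
    {N : ℕ} [NeZero N] (f : CuspForm (Gamma0 N) 2) (hf : IsNewformOf V f)
    (μ : ℚ) (hμ : (μ : ℝ) * V.imaginaryPeriodRat = minusPeriod f)
    (P : (V.quadraticTwist (-2)).toAffine.Point)
    (hgen : ∀ R : (V.quadraticTwist (-2)).toAffine.Point,
      ∃ (k : ℤ) (T : (V.quadraticTwist (-2)).toAffine.Point), IsOfFinAddOrder T ∧ R = k • P + T)
    (Dc : PAdicHeightData (V.quadraticTwist (-2)) 2) (hDc : Dc.IsCanonicalSqMinusTwist)
    (V' : WeierstrassCurve ℚ) [V'.IsElliptic] [V'.IsGloballyMinimal] (C₁' : VariableChange ℚ)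
    (hC₁' : C₁' • V' = cm7.quadraticTwist (d' : ℚ))
    {N' : ℕ} [NeZero N'] (f' : CuspForm (Gamma0 N') 2) (hf' : IsNewformOf V' f')
    (μ' : ℚ) (hμ' : (μ' : ℝ) * V'.imaginaryPeriodRat = minusPeriod f')
    (P' : (V'.quadraticTwist (-2)).toAffine.Point)
    (hgen' : ∀ R : (V'.quadraticTwist (-2)).toAffine.Point,
      ∃ (k : ℤ) (T : (V'.quadraticTwist (-2)).toAffine.Point), IsOfFinAddOrder T ∧ R = k • P' + T)
    (Dc' : PAdicHeightData (V'.quadraticTwist (-2)) 2) (hDc' : Dc'.IsCanonicalSqMinusTwist) :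
    (∑' k : ℕ, PowerSeries.coeff k (padicLFunctionMinusBranch f (unitRoot V 2 : ℚ_[2]) 1) * (k : ℚ_[2]) *
        (-2) ^ (k - 1)).valuation + padicValRat 2 μ - (Dc.pairing P P).valuation =
    (∑' k : ℕ, PowerSeries.coeff k (padicLFunctionMinusBranch f' (unitRoot V' 2 : ℚ_[2]) 1) * (k : ℚ_[2]) *
        (-2) ^ (k - 1)).valuation + padicValRat 2 μ' - (Dc'.pairing P' P').valuation := by
  haveI : Fact (2 : ℕ).Prime := ⟨Nat.prime_two⟩
  obtain ⟨D, hD, hu, r, s, t, -, -, -⟩ := exists_integral_smul_eq_of_models V V' C₁ C₁' hC₁ hC₁'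
  -- (R1) unit root
  have hα := unitRoot_two_eq_of_smul_eq V V' hD (cm7_quadraticTwist_hasGoodReductionAtPrime_two hd4 V C₁ hC₁)
  -- (R2) newform
  have hfV : IsNewformOf V f' := (isNewformOf_iff_of_smul_eq hD f').mp hf'
  obtain ⟨-, hL, -, hOm⟩ := newform_quantities_eq_of_isNewformOf hf hfV (unitRoot V 2 : ℚ_[2])
  -- (R3) period ratio
  obtain ⟨-, hΩ⟩ := periods_eq_of_smul_eq hD hu
  have hreq : μ = μ' :=
    ratio_eq_of_mul_eq V.imaginaryPeriodRat_pos.ne' hμ (by rw [← hΩ, hμ', hOm])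
  -- (R4,R5) height
  have hh : Dc.pairing P P = Dc'.pairing P' P' :=
    pairing_generator_rigid hd4 hsq (d := -2) (Or.inr (Or.inr rfl)) V C₁ hC₁ P hgen Dc hDc V' C₁' hC₁' P' hgen' Dc' hDc'
  rw [← hα, ← hL, ← hreq, hh]

/-! ### §2 ★ (Δ1) from its existential form: one datum per member suffices -/

/-- The member's `49a1`-twist model from the partner's: `C • W = V^{(d*)}` and `C₁ • V = 49a1^{(d′)}` give
`C₀ • W = 49a1^{(d* d′)}` (`(E^{(a)})^{(b)} = E^{(ab)}`, twisting commutes with isomorphisms). [cite: SilvermanAEC2009, X.2 Prop. 2.4 and X.5 Cor. 5.4.1] -/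
theorem exists_member_model_of_partner {d' : ℤ} {ds : ℚ} {V W : WeierstrassCurve ℚ} {C₁ C : VariableChange ℚ}
    (hC₁ : C₁ • V = cm7.quadraticTwist (d' : ℚ)) (hC : C • W = V.quadraticTwist ds) :
    ∃ C₀ : VariableChange ℚ, C₀ • W = cm7.quadraticTwist ((d' : ℚ) * ds) := by
  obtain ⟨C', hC'⟩ := exists_smul_quadraticTwist_of_smul_eq hC₁ ds
  exact ⟨C' * C, by rw [mul_smul, hC, hC', quadraticTwist_quadraticTwist]⟩

/-- ★★ **(Δ1) `stub_law_descent_two` VERBATIM from its EXISTENTIAL FORM.** Suppose that with ONE class function `e_D`, for every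
`7`-free member `W` of each of the three classes (`C₀ • W = 49a1^{(2d′)}`, `49a1^{(−d′)}`, `49a1^{(−2d′)}`, `d′ ≡ 1 (4)` squarefree,
`r_an(W) = 1`) there is SOME datum — a globally minimal partner model `V` with `C₁ • V = 49a1^{(d′)}`, a newform `f` of `V`, the
period ratio, the member's model `C • W = V^{(d*)}`, a generator `P` modulo torsion, a canonical minus-twist datum `Dc` — at which the
`2`-adic valuation identity holds. Then the identity holds at EVERY such datum, i.e. the registered research stub (Δ1) of
`Lines/disegni_pair_two.lean` (v3.5–v3.10; = the hypothesis `hlaw` of `defectKey_sevenFree_of_lawDescent_two`) holds as typed: its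
left-hand side is rigid (`lawLHS_chi8_rigid`, `lawLHS_chi4_rigid`, `lawLHS_chi8'_rigid`) and its right-hand side only sees `W`.
Nothing here proves (Δ1); BSD is not proved by any of this. [cite: MazurTateTeitelbaum1986Invent, §I.14]
[cite: PerrinRiou1987, Thm. 1.3] [cite: MazurSteinTate2006, §1] -/
theorem lawDescent_two_of_forall_exists
    (hex : ∃ e_D : ℤ → ℤ → ℤ,
      (∀ (d' : ℤ), d' % 4 = 1 → Squarefree d' → ¬ (7 : ℤ) ∣ d' →
        ∀ (W : WeierstrassCurve ℚ) [W.IsElliptic] [W.IsGloballyMinimal] (C₀ : VariableChange ℚ),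
          C₀ • W = cm7.quadraticTwist (((2 * d' : ℤ)) : ℚ) → W.analyticRank = 1 →
        ∃ (V : WeierstrassCurve ℚ) (_ : V.IsElliptic) (_ : V.IsGloballyMinimal) (C₁ : VariableChange ℚ),
          C₁ • V = cm7.quadraticTwist (d' : ℚ) ∧
        ∃ (N : ℕ) (_ : NeZero N) (f : CuspForm (Gamma0 N) 2), IsNewformOf V f ∧
        ∃ (ϖ : ℚ), ϖ ≠ 0 ∧ (ϖ : ℝ) * V.realPeriodRat = plusPeriod f ∧
        ∃ (_ : (V.quadraticTwist 2).IsElliptic) (C : VariableChange ℚ), C • W = V.quadraticTwist 2 ∧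
        ∃ (P : (V.quadraticTwist 2).toAffine.Point), ¬ IsOfFinAddOrder P ∧
          (∀ R : (V.quadraticTwist 2).toAffine.Point,
            ∃ (k : ℤ) (T : (V.quadraticTwist 2).toAffine.Point), IsOfFinAddOrder T ∧ R = k • P + T) ∧
        ∃ (Dc : PAdicHeightData (V.quadraticTwist 2) 2), Dc.IsCanonicalSqMinusTwist ∧
          (∑' k : ℕ, PowerSeries.coeff k (padicLFunction f (unitRoot V 2 : ℚ_[2])) * (k : ℚ_[2]) *
              (-2) ^ (k - 1)).valuation + padicValRat 2 ϖ - (Dc.pairing P P).valuation =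
            (padicValNat 2 (Nat.card (AddCommGroup.primaryComponent W.sha 2)) : ℤ) +
              (padicValNat 2 W.tamagawaProduct : ℤ) - 2 * (padicValNat 2 W.torsionOrder : ℤ) + e_D 0 (d' % 8)) ∧
      (∀ (d' : ℤ), d' % 4 = 1 → Squarefree d' → ¬ (7 : ℤ) ∣ d' →
        ∀ (W : WeierstrassCurve ℚ) [W.IsElliptic] [W.IsGloballyMinimal] (C₀ : VariableChange ℚ),
          C₀ • W = cm7.quadraticTwist (((-d' : ℤ)) : ℚ) → W.analyticRank = 1 →
        ∃ (V : WeierstrassCurve ℚ) (_ : V.IsElliptic) (_ : V.IsGloballyMinimal) (C₁ : VariableChange ℚ),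
          C₁ • V = cm7.quadraticTwist (d' : ℚ) ∧
        ∃ (N : ℕ) (_ : NeZero N) (f : CuspForm (Gamma0 N) 2), IsNewformOf V f ∧
        ∃ (μ : ℚ), μ ≠ 0 ∧ (μ : ℝ) * V.imaginaryPeriodRat = minusPeriod f ∧
        ∃ (_ : (V.quadraticTwist (-1)).IsElliptic) (C : VariableChange ℚ), C • W = V.quadraticTwist (-1) ∧
        ∃ (P : (V.quadraticTwist (-1)).toAffine.Point), ¬ IsOfFinAddOrder P ∧
          (∀ R : (V.quadraticTwist (-1)).toAffine.Point,
            ∃ (k : ℤ) (T : (V.quadraticTwist (-1)).toAffine.Point), IsOfFinAddOrder T ∧ R = k • P + T) ∧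
        ∃ (Dc : PAdicHeightData (V.quadraticTwist (-1)) 2), Dc.IsCanonicalSqMinusTwist ∧
          (PowerSeries.coeff 1 (padicLFunctionMinusBranch f (unitRoot V 2 : ℚ_[2]) 1)).valuation + padicValRat 2 μ - (Dc.pairing P P).valuation =
            (padicValNat 2 (Nat.card (AddCommGroup.primaryComponent W.sha 2)) : ℤ) +
              (padicValNat 2 W.tamagawaProduct : ℤ) - 2 * (padicValNat 2 W.torsionOrder : ℤ) + e_D 1 ((-d') % 8)) ∧
      (∀ (d' : ℤ), d' % 4 = 1 → Squarefree d' → ¬ (7 : ℤ) ∣ d' →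
        ∀ (W : WeierstrassCurve ℚ) [W.IsElliptic] [W.IsGloballyMinimal] (C₀ : VariableChange ℚ),
          C₀ • W = cm7.quadraticTwist (((-2 * d' : ℤ)) : ℚ) → W.analyticRank = 1 →
        ∃ (V : WeierstrassCurve ℚ) (_ : V.IsElliptic) (_ : V.IsGloballyMinimal) (C₁ : VariableChange ℚ),
          C₁ • V = cm7.quadraticTwist (d' : ℚ) ∧
        ∃ (N : ℕ) (_ : NeZero N) (f : CuspForm (Gamma0 N) 2), IsNewformOf V f ∧
        ∃ (μ : ℚ), μ ≠ 0 ∧ (μ : ℝ) * V.imaginaryPeriodRat = minusPeriod f ∧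
        ∃ (_ : (V.quadraticTwist (-2)).IsElliptic) (C : VariableChange ℚ), C • W = V.quadraticTwist (-2) ∧
        ∃ (P : (V.quadraticTwist (-2)).toAffine.Point), ¬ IsOfFinAddOrder P ∧
          (∀ R : (V.quadraticTwist (-2)).toAffine.Point,
            ∃ (k : ℤ) (T : (V.quadraticTwist (-2)).toAffine.Point), IsOfFinAddOrder T ∧ R = k • P + T) ∧
        ∃ (Dc : PAdicHeightData (V.quadraticTwist (-2)) 2), Dc.IsCanonicalSqMinusTwist ∧
          (∑' k : ℕ, PowerSeries.coeff k (padicLFunctionMinusBranch f (unitRoot V 2 : ℚ_[2]) 1) * (k : ℚ_[2]) *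
              (-2) ^ (k - 1)).valuation + padicValRat 2 μ - (Dc.pairing P P).valuation =
            (padicValNat 2 (Nat.card (AddCommGroup.primaryComponent W.sha 2)) : ℤ) +
              (padicValNat 2 W.tamagawaProduct : ℤ) - 2 * (padicValNat 2 W.torsionOrder : ℤ) + e_D 0 ((-d') % 8))) :
      ∃ e_D : ℤ → ℤ → ℤ,
      -- the `χ₈∘N`-class: `d = 2d′`, `D = Σ_k k·[T^k]L₂(f,α)·(−2)^{k−1}`, plus period ratio `ϖ`
      (∀ (d' : ℤ), d' % 4 = 1 → Squarefree d' → ¬ (7 : ℤ) ∣ d' →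
        ∀ (V : WeierstrassCurve ℚ) [V.IsElliptic] [V.IsGloballyMinimal] (C₁ : VariableChange ℚ),
          C₁ • V = cm7.quadraticTwist (d' : ℚ) →
        ∀ {N : ℕ} [NeZero N] (f : CuspForm (Gamma0 N) 2), IsNewformOf V f →
        ∀ (ϖ : ℚ), ϖ ≠ 0 → (ϖ : ℝ) * V.realPeriodRat = plusPeriod f →
        ∀ (W : WeierstrassCurve ℚ) [W.IsElliptic] [W.IsGloballyMinimal] [(V.quadraticTwist 2).IsElliptic]
          (C : VariableChange ℚ), C • W = V.quadraticTwist 2 → W.analyticRank = 1 →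
        ∀ (P : (V.quadraticTwist 2).toAffine.Point), ¬ IsOfFinAddOrder P →
          (∀ R : (V.quadraticTwist 2).toAffine.Point,
            ∃ (k : ℤ) (T : (V.quadraticTwist 2).toAffine.Point), IsOfFinAddOrder T ∧ R = k • P + T) →
        ∀ (Dc : PAdicHeightData (V.quadraticTwist 2) 2), Dc.IsCanonicalSqMinusTwist →
          (∑' k : ℕ, PowerSeries.coeff k (padicLFunction f (unitRoot V 2 : ℚ_[2])) * (k : ℚ_[2]) *
              (-2) ^ (k - 1)).valuation + padicValRat 2 ϖ - (Dc.pairing P P).valuation =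
            (padicValNat 2 (Nat.card (AddCommGroup.primaryComponent W.sha 2)) : ℤ) +
              (padicValNat 2 W.tamagawaProduct : ℤ) - 2 * (padicValNat 2 W.torsionOrder : ℤ) + e_D 0 (d' % 8)) ∧
      -- the `χ₋₄∘N`-class: `d = −d′`, `D = [T¹]L₂⁻(f,α)` (derivative at `T = 0` of the minus branch), `μ`
      (∀ (d' : ℤ), d' % 4 = 1 → Squarefree d' → ¬ (7 : ℤ) ∣ d' →
        ∀ (V : WeierstrassCurve ℚ) [V.IsElliptic] [V.IsGloballyMinimal] (C₁ : VariableChange ℚ),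
          C₁ • V = cm7.quadraticTwist (d' : ℚ) →
        ∀ {N : ℕ} [NeZero N] (f : CuspForm (Gamma0 N) 2), IsNewformOf V f →
        ∀ (μ : ℚ), μ ≠ 0 → (μ : ℝ) * V.imaginaryPeriodRat = minusPeriod f →
        ∀ (W : WeierstrassCurve ℚ) [W.IsElliptic] [W.IsGloballyMinimal] [(V.quadraticTwist (-1)).IsElliptic]
          (C : VariableChange ℚ), C • W = V.quadraticTwist (-1) → W.analyticRank = 1 →
        ∀ (P : (V.quadraticTwist (-1)).toAffine.Point), ¬ IsOfFinAddOrder P →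
          (∀ R : (V.quadraticTwist (-1)).toAffine.Point,
            ∃ (k : ℤ) (T : (V.quadraticTwist (-1)).toAffine.Point), IsOfFinAddOrder T ∧ R = k • P + T) →
        ∀ (Dc : PAdicHeightData (V.quadraticTwist (-1)) 2), Dc.IsCanonicalSqMinusTwist →
          (PowerSeries.coeff 1 (padicLFunctionMinusBranch f (unitRoot V 2 : ℚ_[2]) 1)).valuation + padicValRat 2 μ - (Dc.pairing P P).valuation =
            (padicValNat 2 (Nat.card (AddCommGroup.primaryComponent W.sha 2)) : ℤ) +
              (padicValNat 2 W.tamagawaProduct : ℤ) - 2 * (padicValNat 2 W.torsionOrder : ℤ) + e_D 1 ((-d') % 8)) ∧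
      -- the `χ₋₈∘N`-class: `d = −2d′`, `D = Σ_k k·[T^k]L₂⁻(f,α)·(−2)^{k−1}`, `μ`
      (∀ (d' : ℤ), d' % 4 = 1 → Squarefree d' → ¬ (7 : ℤ) ∣ d' →
        ∀ (V : WeierstrassCurve ℚ) [V.IsElliptic] [V.IsGloballyMinimal] (C₁ : VariableChange ℚ),
          C₁ • V = cm7.quadraticTwist (d' : ℚ) →
        ∀ {N : ℕ} [NeZero N] (f : CuspForm (Gamma0 N) 2), IsNewformOf V f →
        ∀ (μ : ℚ), μ ≠ 0 → (μ : ℝ) * V.imaginaryPeriodRat = minusPeriod f →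
        ∀ (W : WeierstrassCurve ℚ) [W.IsElliptic] [W.IsGloballyMinimal] [(V.quadraticTwist (-2)).IsElliptic]
          (C : VariableChange ℚ), C • W = V.quadraticTwist (-2) → W.analyticRank = 1 →
        ∀ (P : (V.quadraticTwist (-2)).toAffine.Point), ¬ IsOfFinAddOrder P →
          (∀ R : (V.quadraticTwist (-2)).toAffine.Point,
            ∃ (k : ℤ) (T : (V.quadraticTwist (-2)).toAffine.Point), IsOfFinAddOrder T ∧ R = k • P + T) →
        ∀ (Dc : PAdicHeightData (V.quadraticTwist (-2)) 2), Dc.IsCanonicalSqMinusTwist →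
          (∑' k : ℕ, PowerSeries.coeff k (padicLFunctionMinusBranch f (unitRoot V 2 : ℚ_[2]) 1) * (k : ℚ_[2]) *
              (-2) ^ (k - 1)).valuation + padicValRat 2 μ - (Dc.pairing P P).valuation =
            (padicValNat 2 (Nat.card (AddCommGroup.primaryComponent W.sha 2)) : ℤ) +
              (padicValNat 2 W.tamagawaProduct : ℤ) - 2 * (padicValNat 2 W.torsionOrder : ℤ) + e_D 0 ((-d') % 8)) := by
  obtain ⟨e_D, h8, h4, h8'⟩ := hex
  refine ⟨e_D, ?_, ?_, ?_⟩
  · intro d' hd4 hsq h7 V _ _ C₁ hC₁ N _ f hf ϖ hϖ0 hϖ W _ _ _ C hC hr P hP hgen Dc hDc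
    obtain ⟨C₀, hC₀⟩ := exists_member_model_of_partner hC₁ hC
    have hC₀' : C₀ • W = cm7.quadraticTwist (((2 * d' : ℤ)) : ℚ) := by
      rw [hC₀]; push_cast; ring_nf
    obtain ⟨V₀, _, _, C₁₀, hC₁₀, N₀, _, f₀, hf₀, ϖ₀, -, hϖ₀, _, C', -, P₀, -, hgen₀, Dc₀, hDc₀, hlaw₀⟩ :=
      h8 d' hd4 hsq h7 W C₀ hC₀' hr
    rw [lawLHS_chi8_rigid hd4 hsq V C₁ hC₁ f hf ϖ hϖ P hgen Dc hDc V₀ C₁₀ hC₁₀ f₀ hf₀ ϖ₀ hϖ₀ P₀ hgen₀ Dc₀ hDc₀]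
    exact hlaw₀
  · intro d' hd4 hsq h7 V _ _ C₁ hC₁ N _ f hf μ hμ0 hμ W _ _ _ C hC hr P hP hgen Dc hDc
    obtain ⟨C₀, hC₀⟩ := exists_member_model_of_partner hC₁ hC
    have hC₀' : C₀ • W = cm7.quadraticTwist (((-d' : ℤ)) : ℚ) := by
      rw [hC₀]; push_cast; ring_nf
    obtain ⟨V₀, _, _, C₁₀, hC₁₀, N₀, _, f₀, hf₀, μ₀, -, hμ₀, _, C', -, P₀, -, hgen₀, Dc₀, hDc₀, hlaw₀⟩ :=
      h4 d' hd4 hsq h7 W C₀ hC₀' hr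
    rw [lawLHS_chi4_rigid hd4 hsq V C₁ hC₁ f hf μ hμ P hgen Dc hDc V₀ C₁₀ hC₁₀ f₀ hf₀ μ₀ hμ₀ P₀ hgen₀ Dc₀ hDc₀]
    exact hlaw₀
  · intro d' hd4 hsq h7 V _ _ C₁ hC₁ N _ f hf μ hμ0 hμ W _ _ _ C hC hr P hP hgen Dc hDc
    obtain ⟨C₀, hC₀⟩ := exists_member_model_of_partner hC₁ hC
    have hC₀' : C₀ • W = cm7.quadraticTwist (((-2 * d' : ℤ)) : ℚ) := by
      rw [hC₀]; push_cast; ring_nf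
    obtain ⟨V₀, _, _, C₁₀, hC₁₀, N₀, _, f₀, hf₀, μ₀, -, hμ₀, _, C', -, P₀, -, hgen₀, Dc₀, hDc₀, hlaw₀⟩ :=
      h8' d' hd4 hsq h7 W C₀ hC₀' hr
    rw [lawLHS_chi8'_rigid hd4 hsq V C₁ hC₁ f hf μ hμ P hgen Dc hDc V₀ C₁₀ hC₁₀ f₀ hf₀ μ₀ hμ₀ P₀ hgen₀ Dc₀ hDc₀]
    exact hlaw₀

end Summit.BirchSwinnertonDyer.BirchSwinnertonDyer.Theorems.PrintCf2.DisegniPairTwo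

end
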